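import Summits.Ventures.PercRepro2.CaseOneJ1
import Summits.Ventures.PercRepro2.K5Marks

/-!
# `(J1)` on every graph with five vertices and five distinct marks (blind cell PercRepro2, p1 g19;
CONJECTURES row 2′J1 — the all-marked base of `(J1)` in the kernel)

typer-1's `K5.jOneOne_card5` gives `(J1₁)` on every graph with exactly five vertices, every five
distinct marks, every weight vector; its hypotheses are symmetric in the roots, so with the mirror
(`jOne_of_jOneOne_of_mirror`) **`jOne_card5`**: `(J1)` itself there. Own code; standard axioms.
-/

namespace Summit.Ventures.PercRepro2

namespace K5

section JOneFive
variable {V : Type*} {E : Type*} [Fintype E] [DecidableEq E] [Fintype V] [DecidableEq V]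
  {R : Type*} [Field R] [LinearOrder R] [IsStrictOrderedRing R]

/-- **`(J1)` on every graph with exactly five vertices, every five distinct marks, every weight
vector.** -/
theorem jOne_card5 (hV : Fintype.card V = 5) (ends : E → Sym2 V) (p : E → R) (hp : IsProbVec p)
    (o a₁ a₂ a₃ b : V) (h01 : o ≠ a₁) (h02 : o ≠ a₂) (h03 : o ≠ a₃) (h04 : o ≠ b)
    (h12 : a₁ ≠ a₂) (h13 : a₁ ≠ a₃) (h14 : a₁ ≠ b) (h23 : a₂ ≠ a₃) (h24 : a₂ ≠ b) (h34 : a₃ ≠ b) :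
    CaseOne.JOne p ends o a₁ a₂ a₃ b :=
  CaseOne.jOne_of_jOneOne_of_mirror p ends o a₁ a₂ a₃ b
    (jOneOne_card5 hV ends p hp o a₁ a₂ a₃ b h01 h02 h03 h04 h12 h13 h14 h23 h24 h34)
    (jOneOne_card5 hV ends p hp o a₂ a₁ a₃ b h02 h01 h03 h04 h12.symm h23 h24 h13 h14 h34)

end JOneFive

end K5

end Summit.Ventures.PercRepro2
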